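import Mathlib
import HarnessLib

/-!
# The delete-one-block jackknife is LINEAR in the statistic: reweighted sector populations still
# sum to one after bias correction — but a corrected population can be negative

HONEST FRAMING: exact (Metropolis-corrected) sampling algorithms for lattice gauge theory;
figures of merit are autocorrelation/cost numbers at stated couplings and volumes; no
continuum-physics claim.

Venture `LatticeQCDFlow` (cell pub-lqcd), topic `Exactness`; FANOUT row 13 (`eng-snf`, GEN-25).
NEW WORK of the cell (elementary algebra), Mathlib only; not a published result; no definition;
nothing cited as a fact (Quenouille / Tukey NAMED ONLY).  Companion of the GEN-25 pseudo-value
files (`…ReplicaJackknifePseudoValues`, `…PseudoValuesMean`, `…RatioBias`).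

WHY (row 13).  `estimators.sector_weights(Q, W)` boards, for every topological sector `k`, the
reweighted population `p_k = reweighted_mean(1_{Q=k}, W)["mean"] = Σ_i w_i 1_{Q_i=k} / Σ_i w_i`
together with its jackknife error, and `reweighted_mean` also returns the Quenouille–Tukey
corrected value `mean_biascorr = g·full − (g−1)·(1/g)Σ_r rep_r`.  Two facts decide which of the
two numbers may be boarded as a POPULATION:
(i) the map `statistic ↦ bias-corrected value` is LINEAR (`jackknife_biasCorrected_add`,
`…_smul`, `…_sum`), so any family of statistics summing to a constant on the full sample AND on
every delete-one-block sample — the sector ratios sum to `1` on every subsample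
(`sum_sectorRatio_eq_one`) — has bias-corrected values summing to the same constant
(`sum_jackknife_biasCorrected_eq_const`, `sum_jackknife_biasCorrected_sectorRatio_eq_one`);
(ii) but positivity is NOT preserved: `jackknife_biasCorrected_neg_witness` — two blocks, full
value `1/8`, replicates `0` and `1`, corrected value `2·(1/8) − (0 + 1)/2 = −1/4 < 0` (realised by
weights `1 | 7` with the sector present only in the first block).  Hence `p_k = full` (in `[0, 1]`,
summing to one) is the boarded population and `mean_biascorr` is a diagnostic only.

NOT CLAIMED: anything stochastic; anything numerical beyond the rational witness.
-/

namespace Summit.Ventures.LatticeQCDFlow.Exactness.GeneralNCMC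

open Finset

section Linearity

variable {ι : Type*} [Fintype ι]

/-- The Quenouille–Tukey corrected value is ADDITIVE in the statistic. -/
theorem jackknife_biasCorrected_add (g : ℝ) (f₁ f₂ : ℝ) (rep₁ rep₂ : ι → ℝ) :
    g * (f₁ + f₂) - (g - 1) * ((∑ r, (rep₁ r + rep₂ r)) / g)
      = (g * f₁ - (g - 1) * ((∑ r, rep₁ r) / g)) + (g * f₂ - (g - 1) * ((∑ r, rep₂ r) / g)) := by
  rw [sum_add_distrib]
  ring

/-- The Quenouille–Tukey corrected value is HOMOGENEOUS in the statistic. -/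
theorem jackknife_biasCorrected_smul (g c : ℝ) (f : ℝ) (rep : ι → ℝ) :
    g * (c * f) - (g - 1) * ((∑ r, c * rep r) / g)
      = c * (g * f - (g - 1) * ((∑ r, rep r) / g)) := by
  rw [← mul_sum]
  ring

/-- The corrected value of a finite SUM of statistics is the sum of the corrected values. -/
theorem jackknife_biasCorrected_sum {K : Type*} (s : Finset K) (g : ℝ) (f : K → ℝ)
    (rep : K → ι → ℝ) :
    g * (∑ k ∈ s, f k) - (g - 1) * ((∑ r, ∑ k ∈ s, rep k r) / g)
      = ∑ k ∈ s, (g * f k - (g - 1) * ((∑ r, rep k r) / g)) := by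
  have h : (∑ r, ∑ k ∈ s, rep k r) / g = ∑ k ∈ s, (∑ r, rep k r) / g := by
    rw [sum_comm, sum_div]
  rw [h, mul_sum, mul_sum, sum_sub_distrib]

/-- **Statistics summing to a constant keep doing so after bias correction**: with `R` blocks
(= replicates), if `Σ_k f_k = c` on the full sample and `Σ_k rep_{k,r} = c` on every
delete-one-block sample, then `Σ_k bias_corr_k = R·c − (R−1)·c = c`. -/
theorem sum_jackknife_biasCorrected_eq_const [Nonempty ι] {K : Type*} (s : Finset K) {f : K → ℝ}
    {rep : K → ι → ℝ} {c : ℝ} (hfull : ∑ k ∈ s, f k = c) (hrep : ∀ r, ∑ k ∈ s, rep k r = c) :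
    ∑ k ∈ s, ((Fintype.card ι : ℝ) * f k
        - ((Fintype.card ι : ℝ) - 1) * ((∑ r, rep k r) / Fintype.card ι)) = c := by
  have hR : (Fintype.card ι : ℝ) ≠ 0 := by positivity
  rw [← jackknife_biasCorrected_sum, hfull]
  simp_rw [hrep]
  rw [sum_const, card_univ, nsmul_eq_mul, mul_div_cancel_left₀ _ hR]
  ring

end Linearity

/-! ## The sector ratios: sum to one on every subsample, hence after correction — with `g = R` -/

section Sectors

variable {ι : Type*} [Fintype ι] {n : Type*} {K : Type*} [Fintype K] [DecidableEq K]

/-- **Reweighted sector populations sum to one** on any subsample `s` carrying weight: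
`Σ_k (Σ_{i∈s} w_i 1_{Q_i = k}) / (Σ_{i∈s} w_i) = 1`. -/
theorem sum_sectorRatio_eq_one (s : Finset n) (w : n → ℝ) (Q : n → K) (hs : ∑ i ∈ s, w i ≠ 0) :
    ∑ k, (∑ i ∈ s, w i * (if Q i = k then 1 else 0)) / (∑ i ∈ s, w i) = 1 := by
  rw [← sum_div, sum_comm]
  have h : ∀ i ∈ s, ∑ k, w i * (if Q i = k then (1 : ℝ) else 0) = w i := fun i _ => by
    rw [← mul_sum, sum_ite_eq, if_pos (mem_univ _), mul_one]
  rw [sum_congr rfl h, div_self hs]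

/-- **The bias-corrected sector populations of `sector_weights` sum to one** (`R ≥ 1` blocks;
full sample and every delete-one-block sample carrying weight). -/
theorem sum_jackknife_biasCorrected_sectorRatio_eq_one [Nonempty ι] (full : Finset n)
    (loo : ι → Finset n) (w : n → ℝ) (Q : n → K) (hfull : ∑ i ∈ full, w i ≠ 0)
    (hloo : ∀ r, ∑ i ∈ loo r, w i ≠ 0) :
    ∑ k, ((Fintype.card ι : ℝ)
            * ((∑ i ∈ full, w i * (if Q i = k then 1 else 0)) / ∑ i ∈ full, w i)
          - ((Fintype.card ι : ℝ) - 1)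
            * ((∑ r, (∑ i ∈ loo r, w i * (if Q i = k then 1 else 0)) / ∑ i ∈ loo r, w i)
                / Fintype.card ι)) = 1 :=
  sum_jackknife_biasCorrected_eq_const univ (sum_sectorRatio_eq_one full w Q hfull)
    fun r => sum_sectorRatio_eq_one (loo r) w Q (hloo r)

end Sectors

/-! ## Positivity is not preserved -/

section Witness

/-- **A bias-corrected population can be NEGATIVE**: two blocks, full value `1/8`, replicates
`0` and `1`: `2·(1/8) − (2−1)·((0 + 1)/2) = −1/4`. (Weights `1 | 7`, the sector present only in
the weight-`1` block: full ratio `1/8`; deleting block 1 leaves ratio `0`, deleting block 2 leaves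
ratio `1`.) -/
theorem jackknife_biasCorrected_neg_witness :
    (2 : ℝ) * (1 / 8) - (2 - 1) * ((∑ r : Fin 2, (![0, 1] : Fin 2 → ℝ) r) / 2) = -1 / 4 ∧
      (2 : ℝ) * (1 / 8) - (2 - 1) * ((∑ r : Fin 2, (![0, 1] : Fin 2 → ℝ) r) / 2) < 0 := by
  rw [Fin.sum_univ_two]
  simp only [Matrix.cons_val_zero, Matrix.cons_val_one]
  norm_num

end Witness

end Summit.Ventures.LatticeQCDFlow.Exactness.GeneralNCMC
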